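import Literature.AlgebraicGeometry.Resolution.MonoidalEFReductionTracked
import HarnessLib

/-!
# [CoP1] Prop. 8.1: the TRACKED reduction `E = F` from the comparability on a subring only

Topic: `Literature/AlgebraicGeometry/Resolution` (proofs only; no new notions, no new named
facts). `MonoidalEFReductionTracked.lean` proves the `E = F` reduction of [CoP1] Prop. 8.1
(V. Cossart, O. Piltant, J. Algebra 320 (2008), proof of Prop. 8.1, HAL p. 23) keeping the
bookkeeping `fⁿ t ⊆ R₀` of property (1) ("`(S₀)_f = S_f`"), under the GLOBAL archimedean
hypothesis `harch` (rank one). In Cossart–Piltant 2019's descent (J. Algebra 529 (2019),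
proof of journal Prop. 4.8, Lemma 4.7: "it is not necessary to assume here that
`dim 𝒪_v̂ = 1` because `h ∈ A`") the extension `v̂` may have higher rank, and the archimedean
comparability holds only on `R₀[f⁻¹]` localized at `v̂`-units (`R₀ = Â`, `f = ι(h)`:
`exists_pow_valuation_le_of_mul_pow_eq`, `ArithmeticalThreefoldsCompletionValuesIso.lean`) —
which is exactly where the tracked loop lives. This file records the consequence:

* `exists_frameStepsTracked_supp_eq_within` — `exists_frameStepsTracked_supp_eq` with `harch`
  replaced by `∀ y ∈ locAtCentre C O, v(y) < 1 → ∃ n, v(y)ⁿ ≤ v(f)` for any subring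
  `C ⊇ R₀ ∋ f⁻¹`; the bound for the pair `(x_{i₁}, x_{i₂})` is `v(x_{i₂})ⁿ ≤ v(f) ≤ v(x_{i₁})`
  (`x_{i₁} ∣ f`). Proof: that of the tracked theorem verbatim around the one call to `harch`;
* `exists_frameStepsTracked_supp_eq_subset_within`, `…_subset_within'` — the same with the new
  generators confined to a subfield `F` (the form consumed by `Prop81MiddleAssembly.lean`).

## Sources

* V. Cossart, O. Piltant, J. Algebra 320 (2008) 1051–1082: Prop. 8.1 and its proof (HAL
  hal-00139124, pp. 22–23). [CossartPiltant2008]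
* V. Cossart, O. Piltant, J. Algebra 529 (2019) 268–535 = arXiv:1412.0868, proof of Prop. 4.8
  with Lemma 4.7 (arXiv v1: Prop. 4.6, p. 53). [CossartPiltant2019]
-/

noncomputable section

namespace Literature.AlgebraicGeometry.Resolution

universe u

open IsLocalRing _root_.Polynomial

section EFReductionTrackedWithin

variable {S : Type u} [CommRing S] [IsDomain S] [IsLocalRing S] {E : Type u} [Field E]
  [Algebra S E] [Algebra.IsAlgebraic S E]
  (hSuc : IsUniversallyCatenaryRing S) (hinj : Function.Injective (algebraMap S E))
  (O : ValuationSubring E) (hSO : ∀ s : S, algebraMap S E s ∈ O)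
  (hdom : ∀ s ∈ maximalIdeal S, O.valuation (algebraMap S E s) < 1)
  (hres : ∀ y : O, ∃ q : S[X], (∃ i, q.coeff i ∉ maximalIdeal S) ∧
    O.valuation (q.eval₂ (algebraMap S E) y) < 1)
  {d : ℕ} (hSdim : ringKrullDim S = d)
  (R₀ : Subring E) (hSR₀ : ∀ s : S, algebraMap S E s ∈ R₀)

omit [IsDomain S] [IsLocalRing S] [Algebra.IsAlgebraic S E] in
/-- `v(f) ≤ v(x_i)` for a monomial `f = u ∏ x_c^{α_c}` with `u, x_c ∈ R ⊆ O` and `α_i > 0`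
(a factor of an element of `O` has larger value). [folklore] -/
private theorem valuation_le_of_monomial {R : Subring E} (hRO : R ≤ O.toSubring) {f u : E}
    (huR : u ∈ R) (x : Fin d → R) (α : Fin d → ℕ) (hf : f = u * ∏ c, (x c : E) ^ α c)
    (i : Fin d) (hαi : 0 < α i) : O.valuation f ≤ O.valuation (x i : E) := by
  classical
  set r : E := u * (x i : E) ^ (α i - 1) * ∏ c ∈ Finset.univ.erase i, (x c : E) ^ α c with hrdef
  have hprod : (∏ c, (x c : E) ^ α c) =
      (x i : E) ^ α i * ∏ c ∈ Finset.univ.erase i, (x c : E) ^ α c :=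
    (Finset.mul_prod_erase Finset.univ (fun c => (x c : E) ^ α c) (Finset.mem_univ i)).symm
  have hpow : (x i : E) ^ α i = (x i : E) ^ (α i - 1) * (x i : E) := by
    rw [← pow_succ, Nat.sub_add_cancel hαi]
  have hr : f = (x i : E) * r := by
    rw [hf, hprod, hpow, hrdef]; ring
  have hrR : r ∈ R :=
    Subring.mul_mem _ (Subring.mul_mem _ huR (Subring.pow_mem _ (x i).2 _))
      (prod_mem fun c _ => Subring.pow_mem _ (x c).2 _)
  have hr1 : O.valuation r ≤ 1 := (O.valuation_le_one_iff _).mpr (hRO hrR)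
  rw [hr, map_mul]
  exact mul_le_of_le_one_right' hr1

set_option maxHeartbeats 1600000 in
include hSuc hinj hSO hdom hres hSdim hSR₀ in
/-- **[CoP1] Prop. 8.1, the tracked reduction to `E = F`, from the comparability on a subring
`C ⊇ R₀ ∋ f⁻¹` only** (for valuations of any rank; the rank-one `exists_frameStepsTracked_supp_eq`
is the case `C = E`). [cite: CossartPiltant2008, proof of Prop. 8.1 (HAL p. 23)]
[cite: CossartPiltant2019, proof of Prop. 4.8 with Lemma 4.7 (arXiv v1: Prop. 4.6, p. 53)] -/
theorem exists_frameStepsTracked_supp_eq_within (f : E) (hfR₀ : f ∈ R₀)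
    (C : Subring E) (hR₀C : R₀ ≤ C) (hfC : f⁻¹ ∈ C)
    (harchC : ∀ y ∈ locAtCentre C O, O.valuation y < 1 →
      ∃ n : ℕ, O.valuation y ^ n ≤ O.valuation f)
    (m : ℕ) :
    ∀ (t : Set E) (_ : t.Finite) (_ : ∀ y ∈ t, ∃ n : ℕ, f ^ n * y ∈ R₀)
      (hTO : (Algebra.adjoin S t).toSubring ≤ O.toSubring)
      (_ : IsRegularLocalRing (locAtCentre (Algebra.adjoin S t).toSubring O))
      (x : Fin d → locAtCentre (Algebra.adjoin S t).toSubring O)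
      (_ : haveI := isLocalRing_locAtCentre hTO
        Ideal.span (Set.range x) = maximalIdeal _)
      (h u w : E) (_ : u ∈ locAtCentre (Algebra.adjoin S t).toSubring O)
      (_ : O.valuation u = 1) (_ : w ∈ locAtCentre (Algebra.adjoin S t).toSubring O)
      (_ : O.valuation w = 1) (α β : Fin d → ℕ)
      (_ : f = u * ∏ c, (x c : E) ^ α c) (_ : h = w * ∏ c, (x c : E) ^ β c)
      (_ : ∀ c, 0 < β c → 0 < α c) (_ : ∃ c, 0 < β c)
      (_ : (Finset.univ.filter (fun c => 0 < α c ∧ β c = 0)).card ≤ m),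
    ∃ (t' : Set E), t ⊆ t' ∧ t'.Finite ∧ (∀ y ∈ t', ∃ n : ℕ, f ^ n * y ∈ R₀) ∧
      ∃ (hT'O : (Algebra.adjoin S t').toSubring ≤ O.toSubring),
        IsRegularLocalRing (locAtCentre (Algebra.adjoin S t').toSubring O) ∧
        locAtCentre (Algebra.adjoin S t).toSubring O ≤
          locAtCentre (Algebra.adjoin S t').toSubring O ∧
        ∃ (x' : Fin d → locAtCentre (Algebra.adjoin S t').toSubring O) (u' w' : E)
          (α' β' : Fin d → ℕ),
          (haveI := isLocalRing_locAtCentre hT'O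
           Ideal.span (Set.range x') = maximalIdeal _) ∧
          u' ∈ locAtCentre (Algebra.adjoin S t').toSubring O ∧ O.valuation u' = 1 ∧
          w' ∈ locAtCentre (Algebra.adjoin S t').toSubring O ∧ O.valuation w' = 1 ∧
          f = u' * ∏ c, (x' c : E) ^ α' c ∧ h = w' * ∏ c, (x' c : E) ^ β' c ∧
          (∀ c, 0 < α' c ↔ 0 < β' c) := by
  classical
  induction m with
  | zero =>
    intro t ht hTR hTO hreg x hx h u w huR hvu hwR hvw α β hf hh hFE hF hm
    refine ⟨t, le_rfl, ht, hTR, hTO, hreg, le_rfl, x, u, w, α, β, hx, huR, hvu, hwR, hvw, hf, hh,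
      fun c => ⟨fun hαc => ?_, hFE c⟩⟩
    by_contra hβc
    have : c ∈ Finset.univ.filter (fun c => 0 < α c ∧ β c = 0) :=
      Finset.mem_filter.mpr ⟨Finset.mem_univ _, hαc, Nat.eq_zero_of_not_pos hβc⟩
    rw [Nat.le_zero, Finset.card_eq_zero] at hm
    rw [hm] at this
    exact absurd this (Finset.notMem_empty _)
  | succ k ih =>
    intro t ht hTR hTO hreg x hx h u w huR hvu hwR hvw α β hf hh hFE hF hm
    by_cases h0 : (Finset.univ.filter (fun c => 0 < α c ∧ β c = 0)).card = 0
    · exact ih t ht hTR hTO hreg x hx h u w huR hvu hwR hvw α β hf hh hFE hF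
        (h0.trans_le (Nat.zero_le _))
    · -- pick `i₁ ∈ E ∖ F`, `i₂ ∈ F`, and the archimedean bound
      obtain ⟨i₁, hi₁⟩ := Finset.card_pos.mp (Nat.pos_of_ne_zero h0)
      obtain ⟨-, hα₁, hβ₁⟩ := Finset.mem_filter.mp hi₁
      obtain ⟨i₂, hβ₂⟩ := hF
      haveI := isLocalRing_locAtCentre hTO
      have hx2m : O.valuation (x i₂ : E) < 1 :=
        (mem_maximalIdeal_locAtCentre_iff hTO _).mp (hx ▸ Ideal.subset_span ⟨i₂, rfl⟩)
      -- `f ≠ 0` (a unit times a product of regular parameters)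
      have hf0 : f ≠ 0 := by
        rw [hf]
        exact mul_ne_zero (ne_zero_of_valuation_eq_one hvu)
          (Finset.prod_ne_zero_iff.mpr fun c _ => pow_ne_zero _
            (coe_rsop_ne_zero_of_frame hSuc hinj O hSO hdom hres hSdim t ht hTO hreg x hx c))
      -- `x i₂` lies in `locAtCentre C O`: `t ⊆ R₀[f⁻¹] ⊆ C`, `S ⊆ R₀ ⊆ C`
      have htC : (Algebra.adjoin S t).toSubring ≤ C := by
        let C' : Subalgebra S E := { C with algebraMap_mem' := fun s => hR₀C (hSR₀ s) }
        have h : Algebra.adjoin S t ≤ C' := by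
          rw [Algebra.adjoin_le_iff]
          intro y hy
          obtain ⟨n, hn⟩ := hTR y hy
          have : y = (f⁻¹) ^ n * (f ^ n * y) := by
            rw [← mul_assoc, ← mul_pow, inv_mul_cancel₀ hf0, one_pow, one_mul]
          change y ∈ C
          rw [this]
          exact Subring.mul_mem _ (Subring.pow_mem _ hfC _) (hR₀C hn)
        intro y hy
        exact h hy
      have hRC : locAtCentre (Algebra.adjoin S t).toSubring O ≤ locAtCentre C O :=
        (locAtCentre_mono O htC)
      obtain ⟨n, hn0⟩ := harchC (x i₂ : E) (hRC (x i₂).2) hx2m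
      have hn : O.valuation (x i₂ : E) ^ n ≤ O.valuation (x i₁ : E) :=
        hn0.trans (valuation_le_of_monomial O (locAtCentre_le hTO) huR x α hf i₁ hα₁)
      obtain ⟨t', htt', ht', hTR', hT'O, hreg', x', u', w', α', β', hspan', hu'R, hvu', hw'R, hvw',
        hf', hh', hFE', hF', hcard⟩ :=
        exists_frameStepsTracked_measure_lt hSuc hinj O hSO hdom hres hSdim R₀ hSR₀ f hfR₀ n t ht
          hTR hTO hreg x hx h u w huR hvu hwR hvw α β hf hh hFE i₁ i₂ hα₁ hβ₁ hβ₂ hn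
      have hsub : locAtCentre (Algebra.adjoin S t).toSubring O ≤
          locAtCentre (Algebra.adjoin S t').toSubring O :=
        locAtCentre_mono O (fun y hy => Algebra.adjoin_mono htt' hy)
      obtain ⟨t'', ht't'', ht'', hTR'', hT''O, hreg'', hsub'', x'', u'', w'', α'', β'', hspan'',
        hu''R, hvu'', hw''R, hvw'', hf'', hh'', hiff⟩ :=
        ih t' ht' hTR' hT'O hreg' x' hspan' h u' w' hu'R hvu' hw'R hvw' α' β' hf' hh' hFE' hF'
          (Nat.le_of_lt_succ (lt_of_lt_of_le hcard hm))
      exact ⟨t'', htt'.trans ht't'', ht'', hTR'', hT''O, hreg'', hsub.trans hsub'', x'', u'', w'',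
        α'', β'', hspan'', hu''R, hvu'', hw''R, hvw'', hf'', hh'', hiff⟩

omit [IsDomain S] [IsLocalRing S] [Algebra.IsAlgebraic S E] in
include hSR₀ in
/-- A tracked generating set (`fⁿ t ⊆ R₀`) lies in any subring `C ⊇ R₀ ∋ f⁻¹`, hence so does
`S[t]`. [folklore] -/
private theorem adjoin_le_of_tracked (C : Subring E) (hR₀C : R₀ ≤ C) {f : E} (hfC : f⁻¹ ∈ C)
    (hf0 : f ≠ 0) (t : Set E) (hTR : ∀ y ∈ t, ∃ n : ℕ, f ^ n * y ∈ R₀) :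
    (Algebra.adjoin S t).toSubring ≤ C := by
  let C' : Subalgebra S E := { C with algebraMap_mem' := fun s => hR₀C (hSR₀ s) }
  have h : Algebra.adjoin S t ≤ C' := by
    rw [Algebra.adjoin_le_iff]
    intro y hy
    obtain ⟨n, hn⟩ := hTR y hy
    have : y = (f⁻¹) ^ n * (f ^ n * y) := by
      rw [← mul_assoc, ← mul_pow, inv_mul_cancel₀ hf0, one_pow, one_mul]
    change y ∈ C
    rw [this]
    exact Subring.mul_mem _ (Subring.pow_mem _ hfC _) (hR₀C hn)
  intro y hy
  exact h hy


set_option maxHeartbeats 1600000 in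
include hSuc hinj hSO hdom hres hSdim hSR₀ in
/-- `exists_frameStepsTracked_supp_eq_within` with the new generators confined to a subfield
`F ⊇ S ∪ t` (the tracked, confined `E = F` reduction from the comparability on `locAtCentre C O`).
[cite: CossartPiltant2008, proof of Prop. 8.1 (HAL p. 23)] -/
theorem exists_frameStepsTracked_supp_eq_subset_within (f : E) (hfR₀ : f ∈ R₀)
    (F : Subfield E) (hSF : ∀ s : S, algebraMap S E s ∈ F)
    (C : Subring E) (hR₀C : R₀ ≤ C) (hfC : f⁻¹ ∈ C)
    (harchC : ∀ y ∈ locAtCentre C O, O.valuation y < 1 →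
      ∃ n : ℕ, O.valuation y ^ n ≤ O.valuation f)
    (m : ℕ) :
    ∀ (t : Set E) (_ : t.Finite) (_ : t ⊆ F) (_ : ∀ y ∈ t, ∃ n : ℕ, f ^ n * y ∈ R₀)
      (hTO : (Algebra.adjoin S t).toSubring ≤ O.toSubring)
      (_ : IsRegularLocalRing (locAtCentre (Algebra.adjoin S t).toSubring O))
      (x : Fin d → locAtCentre (Algebra.adjoin S t).toSubring O)
      (_ : haveI := isLocalRing_locAtCentre hTO
        Ideal.span (Set.range x) = maximalIdeal _)
      (h u w : E) (_ : u ∈ locAtCentre (Algebra.adjoin S t).toSubring O)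
      (_ : O.valuation u = 1) (_ : w ∈ locAtCentre (Algebra.adjoin S t).toSubring O)
      (_ : O.valuation w = 1) (α β : Fin d → ℕ)
      (_ : f = u * ∏ c, (x c : E) ^ α c) (_ : h = w * ∏ c, (x c : E) ^ β c)
      (_ : ∀ c, 0 < β c → 0 < α c) (_ : ∃ c, 0 < β c)
      (_ : (Finset.univ.filter (fun c => 0 < α c ∧ β c = 0)).card ≤ m),
    ∃ (t' : Set E), t ⊆ t' ∧ t'.Finite ∧ t' ⊆ F ∧ (∀ y ∈ t', ∃ n : ℕ, f ^ n * y ∈ R₀) ∧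
      ∃ (hT'O : (Algebra.adjoin S t').toSubring ≤ O.toSubring),
        IsRegularLocalRing (locAtCentre (Algebra.adjoin S t').toSubring O) ∧
        locAtCentre (Algebra.adjoin S t).toSubring O ≤
          locAtCentre (Algebra.adjoin S t').toSubring O ∧
        ∃ (x' : Fin d → locAtCentre (Algebra.adjoin S t').toSubring O) (u' w' : E)
          (α' β' : Fin d → ℕ),
          (haveI := isLocalRing_locAtCentre hT'O
           Ideal.span (Set.range x') = maximalIdeal _) ∧
          u' ∈ locAtCentre (Algebra.adjoin S t').toSubring O ∧ O.valuation u' = 1 ∧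
          w' ∈ locAtCentre (Algebra.adjoin S t').toSubring O ∧ O.valuation w' = 1 ∧
          f = u' * ∏ c, (x' c : E) ^ α' c ∧ h = w' * ∏ c, (x' c : E) ^ β' c ∧
          (∀ c, 0 < α' c ↔ 0 < β' c) := by
  classical
  induction m with
  | zero =>
    intro t ht htF hTR hTO hreg x hx h u w huR hvu hwR hvw α β hf hh hFE hF hm
    refine ⟨t, le_rfl, ht, htF, hTR, hTO, hreg, le_rfl, x, u, w, α, β, hx, huR, hvu, hwR, hvw,
      hf, hh, fun c => ⟨fun hαc => ?_, hFE c⟩⟩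
    by_contra hβc
    have : c ∈ Finset.univ.filter (fun c => 0 < α c ∧ β c = 0) :=
      Finset.mem_filter.mpr ⟨Finset.mem_univ _, hαc, Nat.eq_zero_of_not_pos hβc⟩
    rw [Nat.le_zero, Finset.card_eq_zero] at hm
    rw [hm] at this
    exact absurd this (Finset.notMem_empty _)
  | succ k ih =>
    intro t ht htF hTR hTO hreg x hx h u w huR hvu hwR hvw α β hf hh hFE hF hm
    by_cases h0 : (Finset.univ.filter (fun c => 0 < α c ∧ β c = 0)).card = 0
    · exact ih t ht htF hTR hTO hreg x hx h u w huR hvu hwR hvw α β hf hh hFE hF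
        (h0.trans_le (Nat.zero_le _))
    · -- pick `i₁ ∈ E ∖ F`, `i₂ ∈ F`, and the archimedean bound
      obtain ⟨i₁, hi₁⟩ := Finset.card_pos.mp (Nat.pos_of_ne_zero h0)
      obtain ⟨-, hα₁, hβ₁⟩ := Finset.mem_filter.mp hi₁
      obtain ⟨i₂, hβ₂⟩ := hF
      haveI := isLocalRing_locAtCentre hTO
      have hx2m : O.valuation (x i₂ : E) < 1 :=
        (mem_maximalIdeal_locAtCentre_iff hTO _).mp (hx ▸ Ideal.subset_span ⟨i₂, rfl⟩)
      have hf0 : f ≠ 0 := by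
        rw [hf]
        exact mul_ne_zero (ne_zero_of_valuation_eq_one hvu)
          (Finset.prod_ne_zero_iff.mpr fun c _ => pow_ne_zero _
            (coe_rsop_ne_zero_of_frame hSuc hinj O hSO hdom hres hSdim t ht hTO hreg x hx c))
      have htC : (Algebra.adjoin S t).toSubring ≤ C :=
        adjoin_le_of_tracked R₀ hSR₀ C hR₀C hfC hf0 t hTR
      have hRC : locAtCentre (Algebra.adjoin S t).toSubring O ≤ locAtCentre C O :=
        locAtCentre_mono O htC
      obtain ⟨n, hn0⟩ := harchC (x i₂ : E) (hRC (x i₂).2) hx2m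
      have hn : O.valuation (x i₂ : E) ^ n ≤ O.valuation (x i₁ : E) :=
        hn0.trans (valuation_le_of_monomial O (locAtCentre_le hTO) huR x α hf i₁ hα₁)
      obtain ⟨t', htt', ht', ht'F, hTR', hT'O, hreg', x', u', w', α', β', hspan', hu'R, hvu',
        hw'R, hvw', hf', hh', hFE', hF', hcard⟩ :=
        exists_frameStepsTracked_measure_lt_subset hSuc hinj O hSO hdom hres hSdim R₀ hSR₀ f hfR₀ F
          hSF n t ht htF hTR hTO hreg x hx h u w huR hvu hwR hvw α β hf hh hFE i₁ i₂ hα₁ hβ₁ hβ₂ hn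
      have hsub : locAtCentre (Algebra.adjoin S t).toSubring O ≤
          locAtCentre (Algebra.adjoin S t').toSubring O :=
        locAtCentre_mono O (fun y hy => Algebra.adjoin_mono htt' hy)
      obtain ⟨t'', ht't'', ht'', ht''F, hTR'', hT''O, hreg'', hsub'', x'', u'', w'', α'', β'',
        hspan'', hu''R, hvu'', hw''R, hvw'', hf'', hh'', hiff⟩ :=
        ih t' ht' ht'F hTR' hT'O hreg' x' hspan' h u' w' hu'R hvu' hw'R hvw' α' β' hf' hh' hFE' hF'
          (Nat.le_of_lt_succ (lt_of_lt_of_le hcard hm))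
      exact ⟨t'', htt'.trans ht't'', ht'', ht''F, hTR'', hT''O, hreg'', hsub.trans hsub'', x'', u'',
        w'', α'', β'', hspan'', hu''R, hvu'', hw''R, hvw'', hf'', hh'', hiff⟩

set_option maxHeartbeats 400000 in
include hSuc hinj hSO hdom hres hSdim hSR₀ in
/-- `exists_frameStepsTracked_supp_eq_subset_within` at the given stage (the form of
`exists_frameStepsTracked_supp_eq_of_rankOne_subset`, with the rank-one hypothesis replaced by
the comparability on `locAtCentre C O`, `C ⊇ R₀ ∋ f⁻¹`).
[cite: CossartPiltant2008, proof of Prop. 8.1 (HAL p. 23)] -/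
theorem exists_frameStepsTracked_supp_eq_subset_within' (f : E) (hfR₀ : f ∈ R₀)
    (F : Subfield E) (hSF : ∀ s : S, algebraMap S E s ∈ F)
    (C : Subring E) (hR₀C : R₀ ≤ C) (hfC : f⁻¹ ∈ C)
    (harchC : ∀ y ∈ locAtCentre C O, O.valuation y < 1 →
      ∃ n : ℕ, O.valuation y ^ n ≤ O.valuation f)
    (t : Set E) (ht : t.Finite) (htF : t ⊆ F) (hTR : ∀ y ∈ t, ∃ n : ℕ, f ^ n * y ∈ R₀)
    (hTO : (Algebra.adjoin S t).toSubring ≤ O.toSubring)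
    (hreg : IsRegularLocalRing (locAtCentre (Algebra.adjoin S t).toSubring O))
    (x : Fin d → locAtCentre (Algebra.adjoin S t).toSubring O)
    (hx : haveI := isLocalRing_locAtCentre hTO
      Ideal.span (Set.range x) = maximalIdeal _)
    (h u w : E) (huR : u ∈ locAtCentre (Algebra.adjoin S t).toSubring O)
    (hvu : O.valuation u = 1) (hwR : w ∈ locAtCentre (Algebra.adjoin S t).toSubring O)
    (hvw : O.valuation w = 1) (α β : Fin d → ℕ)
    (hf : f = u * ∏ c, (x c : E) ^ α c) (hh : h = w * ∏ c, (x c : E) ^ β c)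
    (hFE : ∀ c, 0 < β c → 0 < α c) (hF : ∃ c, 0 < β c) :
    ∃ (t' : Set E), t ⊆ t' ∧ t'.Finite ∧ t' ⊆ F ∧ (∀ y ∈ t', ∃ n : ℕ, f ^ n * y ∈ R₀) ∧
      ∃ (hT'O : (Algebra.adjoin S t').toSubring ≤ O.toSubring),
        IsRegularLocalRing (locAtCentre (Algebra.adjoin S t').toSubring O) ∧
        locAtCentre (Algebra.adjoin S t).toSubring O ≤
          locAtCentre (Algebra.adjoin S t').toSubring O ∧
        ∃ (x' : Fin d → locAtCentre (Algebra.adjoin S t').toSubring O) (u' w' : E)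
          (α' β' : Fin d → ℕ),
          (haveI := isLocalRing_locAtCentre hT'O
           Ideal.span (Set.range x') = maximalIdeal _) ∧
          u' ∈ locAtCentre (Algebra.adjoin S t').toSubring O ∧ O.valuation u' = 1 ∧
          w' ∈ locAtCentre (Algebra.adjoin S t').toSubring O ∧ O.valuation w' = 1 ∧
          f = u' * ∏ c, (x' c : E) ^ α' c ∧ h = w' * ∏ c, (x' c : E) ^ β' c ∧
          (∀ c, 0 < α' c ↔ 0 < β' c) :=
  exists_frameStepsTracked_supp_eq_subset_within hSuc hinj O hSO hdom hres hSdim R₀ hSR₀ f hfR₀ F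
    hSF C hR₀C hfC harchC _ t ht htF hTR hTO hreg x hx h u w huR hvu hwR hvw α β hf hh hFE hF le_rfl

end EFReductionTrackedWithin

end Literature.AlgebraicGeometry.Resolution

end
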